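import Literature.AnabelianGeometry.EtaleTheta.Discharge.Sec2Cor219iiiHeartPrelims
import HarnessLib

/-!
# [EtTh] Cor. 2.19 (iii), tower form — M1 of row «COR219III-AT-MODELTATE»: the local-constancy inputs of the generic assembly
# `heart_of_uniqueness_of_onto` discharged, and the heart from (D1*) + (D1′) ALONE (proof-only)

S. Mochizuki, *The étale theta function and its Frobenioid-theoretic manifestations*, Publ. RIMS **45** (2009) [EtTh], §2,
Cor. 2.19 (iii), PRIMS PDF p. 65; Def. 2.13 p. 46 (the mod-`N` theta cocycles are locally constant)
[cite: MochizukiEtTh2009, Cor 2.19(iii) p.65].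

Cell `abc-iut`, seat abc-iut-f-142 (gen 5), K-L6 row «COR219III-M1»; sequel of this seat's `Sec2Cor219iiiHeartPrelims.lean`
(p476182 / p476555 / p476906 / p477045).  PROOF-ONLY (no definition, no instance, no notation, no new named fact); GENERIC over every
§1 setting; abc-iut-w4-d038's `exists_transport` (clause (c)) / PART 1 `exists_rootCocycle_conj` and the tower's `locallyConstant`
consumed BY NAME.

WHAT IS SHOWN.
* `conjRoot_red_isLocallyConstant` — for a root cocycle `f` and `σ ∈ Π^tp_X̲̲`, `g ↦ red_M (conjRoot σ f g)` is locally constant on `Π^tp_Ÿ̲̲`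
  (`conjRoot σ f` IS a root cocycle — PART 1 — and mod-`M` theta cocycles are locally constant).
* `pullbackCocycle_isLocallyConstant` — the pull-back of a locally constant `μ_M`-valued function along a bi-continuous `γ` is locally
  constant; hence `transport_red_isLocallyConstant` — `g ↦ red_M (F g)` for the transport `F = Φ_γ f` (clause (c) of `exists_transport`).
* **`heart_of_uniqueness_of_onto'`** — the generic assembly with the two local-constancy hypotheses REMOVED: M1's conclusion
  `∃ m, ∀ k ∈ Δ_P, red_M (F k) = red_M (conjRoot (ã^m) f k)` from (D1*) «uniqueness on `Δ_P`» and (D1′) «`m ↦ red_M θ[ã^{-m}, b]` onto»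
  alone (plus the Cor. 2.19 (iii) data: an admitted `γ̄_M`).  At a model the two remaining inputs are ONE density fact and ONE generation
  fact (see the file's predecessor, §6 docstring).
v2 (append-only, §2): `onto_of_zpowers_comm` — (D1′) from the powers of ONE commutator `red_M θ[ã⁻¹, b]` (bilinearity); and
`uniqueness_on_DeltaP_of_dense` — (D1*) from the DENSITY of the subgroup of `Δ_P` generated by `Δ_P ∩ θ⁻¹(Δ_Θ)` and `b`.
v3 (append-only, §3): **`heart_of_dense_of_zpowers`** — M1 from the TWO model facts (density in `Δ_P`; powers of `red_M θ[ã⁻¹,b]`).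
HONEST FRAMING: unconditional statements about OUR typed objects over an arbitrary §1 setting; nothing of [EtTh] (refereed) asserted beyond
what is proved; no side taken on [IUTchIII] Cor. 3.12; typed ≠ proved; no abc claim.
-/

noncomputable section

namespace Literature.AnabelianGeometry.EtaleTheta

open Literature.AnabelianGeometry.SemiGraphs

namespace ThetaSetting.EtaleThetaData.DoubleUnderline

variable {p : ℕ} [Fact p.Prime] {D : ThetaSetting p} {E : D.EtaleThetaData} {l : ℕ}
  (C : E.DoubleUnderline l) {Es : Set ℕ+} (τ : D.CyclotomeTower l Es)

/-- **`g ↦ red_M (conjRoot σ f g)` is locally constant on `Π^tp_Ÿ̲̲`** for a root cocycle `f` and `σ ∈ Π^tp_X̲̲`: `conjRoot σ f` is again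
a root cocycle (PART 1 `exists_rootCocycle_conj`), so its reduction is a mod-`M` theta cocycle, locally constant by the tower axiom.
[cite: MochizukiEtTh2009, Def 2.13 p.46] -/
theorem conjRoot_red_isLocallyConstant (hC : D.Compat) (hS : D.Sec2Hyps) (M : Es)
    {f : contCocycles D.toTheta D.DeltaTheta C.GtpYdduu} (hf : f ∈ C.rootCocycles hC) (σ : C.Huu) :
    IsLocallyConstant fun g : (C.thetaEnvTower τ hC hS).PiYdd =>
      (τ.mod M).red ⟨(C.conjRoot hC σ f.1 (C.inclYdduu g) : D.GtpTheta),
        (D.lDeltaTheta_normal l).conj_mem _ (hf.1 _) _⟩ := by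
  obtain ⟨f', hf', hff'⟩ := C.exists_rootCocycle_conj hC σ f hf
  have hη : C.modN (τ.mod M) f' hf'.1 ∈ (C.thetaEnvTower τ hC hS).thetaCocycles M := ⟨f', hf', rfl⟩
  have hlc := (C.thetaEnvTower τ hC hS).locallyConstant M _ hη
  have heq : (fun g : (C.thetaEnvTower τ hC hS).PiYdd =>
      (τ.mod M).red ⟨(C.conjRoot hC σ f.1 (C.inclYdduu g) : D.GtpTheta),
        (D.lDeltaTheta_normal l).conj_mem _ (hf.1 _) _⟩) = C.modN (τ.mod M) f' hf'.1 := by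
    funext g
    change _ = (τ.mod M).red ⟨(f'.1 (C.inclYdduu g) : D.GtpTheta), hf'.1 _⟩
    congr 2
    rw [hff']
    rfl
  rw [heq]
  exact hlc

/-- **Pull-backs of locally constant functions along `γ` are locally constant**: `pullbackCocycle M γ hγ γ̄_M η = γ̄_M⁻¹ ∘ η ∘ γ` with
`γ` continuous. [cite: MochizukiEtTh2009, Cor 2.19(iii) p.65] -/
theorem pullbackCocycle_isLocallyConstant (hC : D.Compat) (hS : D.Sec2Hyps) (M : Es)
    (γ : (C.thetaEnvTower τ hC hS).PiX ≃ₜ* (C.thetaEnvTower τ hC hS).PiX)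
    (hγ : (C.thetaEnvTower τ hC hS).PiYdd.map γ.toMulEquiv.toMonoidHom = (C.thetaEnvTower τ hC hS).PiYdd)
    (γμ : (C.thetaEnvTower τ hC hS).mu M ≃* (C.thetaEnvTower τ hC hS).mu M)
    {η : (C.thetaEnvTower τ hC hS).PiYdd → (C.thetaEnvTower τ hC hS).mu M} (hη : IsLocallyConstant η) :
    IsLocallyConstant ((C.thetaEnvTower τ hC hS).pullbackCocycle M γ hγ γμ η) := by
  have hcont : Continuous fun g : (C.thetaEnvTower τ hC hS).PiYdd =>
      (⟨γ g, C.apply_mem_PiYdd τ hC hS γ hγ g⟩ : (C.thetaEnvTower τ hC hS).PiYdd) :=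
    Continuous.subtype_mk (γ.continuous.comp continuous_subtype_val) _
  exact ((hη.comp_continuous hcont).comp γμ.symm)

/-- **`g ↦ red_M (F g)` is locally constant** for the transport `F = Φ_γ f` of a root cocycle: by clause (c) of `exists_transport` it is the
pull-back of the (locally constant) mod-`M` theta cocycle `modN f`. [cite: MochizukiEtTh2009, Cor 2.19(iii) p.65] -/
theorem transport_red_isLocallyConstant (hC : D.Compat) (hS : D.Sec2Hyps) (M : Es)
    (γ : (C.thetaEnvTower τ hC hS).PiX ≃ₜ* (C.thetaEnvTower τ hC hS).PiX)
    (hγ : (C.thetaEnvTower τ hC hS).PiYdd.map γ.toMulEquiv.toMonoidHom = (C.thetaEnvTower τ hC hS).PiYdd)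
    (γμ : (C.thetaEnvTower τ hC hS).mu M ≃* (C.thetaEnvTower τ hC hS).mu M)
    {f : contCocycles D.toTheta D.DeltaTheta C.GtpYdduu} (hf : f ∈ C.rootCocycles hC)
    (F : C.GtpYdduu → D.lDeltaTheta l)
    (hFc : (C.thetaEnvTower τ hC hS).pullbackCocycle M γ hγ γμ (C.modN (τ.mod M) f hf.1) =
      fun g => (τ.mod M).red (F (C.inclYdduu g))) :
    IsLocallyConstant fun g : (C.thetaEnvTower τ hC hS).PiYdd => (τ.mod M).red (F (C.inclYdduu g)) := by
  rw [← hFc]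
  exact C.pullbackCocycle_isLocallyConstant τ hC hS M γ hγ γμ
    ((C.thetaEnvTower τ hC hS).locallyConstant M _ ⟨f, hf, rfl⟩)

/-- **M1 from (D1*) and (D1′) alone (generic).**  The assembly `heart_of_uniqueness_of_onto` with its two local-constancy hypotheses
discharged by the two lemmas above: given the Cor. 2.19 (iii) data at level `M` (an admitted `γ̄_M`, and `F` with clauses (a), (b), (c) of
`exists_transport`), a root cocycle `f`, geometric `ã ∈ Π^tp_X̲̲`, `b ∈ Δ_P`, (D1*) uniqueness on `Δ_P` and (D1′) onto ⟹
`∃ m : ℤ, ∀ k ∈ Δ_P, red_M (F k) = red_M (conjRoot (ã^m) f k)`. [cite: MochizukiEtTh2009, Cor 2.19(iii) p.65] -/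
theorem heart_of_uniqueness_of_onto' (hC : D.Compat) (hS : D.Sec2Hyps) (h15 : Prop15iii E hC)
    (γ : (C.thetaEnvTower τ hC hS).PiX ≃ₜ* (C.thetaEnvTower τ hC hS).PiX)
    (hγ : (C.thetaEnvTower τ hC hS).PiYdd.map γ.toMulEquiv.toMonoidHom = (C.thetaEnvTower τ hC hS).PiYdd)
    (hL : (C.thetaEnvTower τ hC hS).lDeltaTheta.map γ.toMulEquiv.toMonoidHom = (C.thetaEnvTower τ hC hS).lDeltaTheta)
    (γΛ : D.lDeltaTheta l ≃* D.lDeltaTheta l)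
    (hγΛ : ∀ (g : (C.thetaEnvTower τ hC hS).lDeltaTheta) (hg : γ g ∈ (C.thetaEnvTower τ hC hS).lDeltaTheta),
      C.toLDelta ⟨γ g, hg⟩ = γΛ (C.toLDelta g))
    (M : Es) (γμ : (C.thetaEnvTower τ hC hS).mu M ≃* (C.thetaEnvTower τ hC hS).mu M)
    {f : contCocycles D.toTheta D.DeltaTheta C.GtpYdduu} (hf : f ∈ C.rootCocycles hC)
    (F : C.GtpYdduu → D.lDeltaTheta l)
    (hF : ∀ g : (C.thetaEnvTower τ hC hS).PiYdd,
      F (C.inclYdduu g) = γΛ.symm ⟨(f.1 (C.inclYdduu ⟨γ g, C.apply_mem_PiYdd τ hC hS γ hγ g⟩) : D.GtpTheta), hf.1 _⟩)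
    (hFmul : ∀ g h : C.GtpYdduu, (F (g * h) : D.GtpTheta) =
      (F g : D.GtpTheta) * (D.toTheta (g : D.PiTemp) * (F h : D.GtpTheta) * (D.toTheta (g : D.PiTemp))⁻¹))
    (hFc : (C.thetaEnvTower τ hC hS).pullbackCocycle M γ hγ γμ (C.modN (τ.mod M) f hf.1) =
      fun g => (τ.mod M).red (F (C.inclYdduu g)))
    (a : C.Huu) (ha : D.aug.toMonoidHom (a : D.PiTemp) = 1)
    (b : (C.thetaEnvTower τ hC hS).PiYdd) (hb : D.aug.toMonoidHom ((b : C.Huu) : D.PiTemp) = 1)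
    (huniq : ∀ φ ψ : (C.thetaEnvTower τ hC hS).PiYdd → MuN p M, IsLocallyConstant φ → IsLocallyConstant ψ →
      (∀ g h : (C.thetaEnvTower τ hC hS).PiYdd, D.aug.toMonoidHom ((g : C.Huu) : D.PiTemp) = 1 →
        D.aug.toMonoidHom ((h : C.Huu) : D.PiTemp) = 1 → φ (g * h) = φ g * φ h) →
      (∀ g h : (C.thetaEnvTower τ hC hS).PiYdd, D.aug.toMonoidHom ((g : C.Huu) : D.PiTemp) = 1 →
        D.aug.toMonoidHom ((h : C.Huu) : D.PiTemp) = 1 → ψ (g * h) = ψ g * ψ h) →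
      (∀ g : (C.thetaEnvTower τ hC hS).PiYdd, D.aug.toMonoidHom ((g : C.Huu) : D.PiTemp) = 1 →
        D.toTheta ((g : C.Huu) : D.PiTemp) ∈ D.DeltaTheta → φ g = ψ g) →
      φ b = ψ b →
      ∀ g : (C.thetaEnvTower τ hC hS).PiYdd, D.aug.toMonoidHom ((g : C.Huu) : D.PiTemp) = 1 → φ g = ψ g)
    (honto : ∀ u : MuN p M, ∃ (m : ℤ) (hm : D.toTheta ((((a ^ m : C.Huu) : D.PiTemp))⁻¹ * ((b : C.Huu) : D.PiTemp) *
        ((a ^ m : C.Huu) : D.PiTemp) * (((b : C.Huu) : D.PiTemp))⁻¹) ∈ D.lDeltaTheta l), (τ.mod M).red ⟨_, hm⟩ = u) :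
    ∃ m : ℤ, ∀ g : (C.thetaEnvTower τ hC hS).PiYdd, D.aug.toMonoidHom ((g : C.Huu) : D.PiTemp) = 1 →
      (τ.mod M).red (F (C.inclYdduu g)) =
        (τ.mod M).red ⟨(C.conjRoot hC (a ^ m) f.1 (C.inclYdduu g) : D.GtpTheta),
          (D.lDeltaTheta_normal l).conj_mem _ (hf.1 _) _⟩ :=
  C.heart_of_uniqueness_of_onto τ hC hS h15 γ hγ hL γΛ hγΛ hf F hF hFmul a ha b hb M huniq honto
    (C.transport_red_isLocallyConstant τ hC hS M γ hγ γμ hf F hFc)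
    (fun m => C.conjRoot_red_isLocallyConstant τ hC hS M hf (a ^ m))

end ThetaSetting.EtaleThetaData.DoubleUnderline

/-! ## §2 (v2, append-only). (D1′) from the powers of ONE commutator; (D1*) from density -/

namespace ThetaSetting.EtaleThetaData.DoubleUnderline

variable {p : ℕ} [Fact p.Prime] {D : ThetaSetting p} {E : D.EtaleThetaData} {l : ℕ}
  (C : E.DoubleUnderline l) {Es : Set ℕ+} (τ : D.CyclotomeTower l Es)

/-- **(D1′) from ONE commutator.**  If the integer powers of `red_M θ[ã⁻¹, b]` exhaust `μ_M` (e.g. `red_M θ[ã⁻¹, b]` generates the cyclic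
group `μ_M`), then `m ↦ red_M θ[ã^{-m}, b]` is onto — by the bilinearity `θ[ã^{-m}, b] = θ[ã⁻¹, b]^m` (`toTheta_conj_zpow_comm`).
[cite: MochizukiEtTh2009, Cor 2.19(iii) p.65] -/
theorem onto_of_zpowers_comm (hC : D.Compat) (hS : D.Sec2Hyps) (M : Es) (a : C.Huu)
    (ha : D.aug.toMonoidHom (a : D.PiTemp) = 1)
    (b : (C.thetaEnvTower τ hC hS).PiYdd) (hb : D.aug.toMonoidHom ((b : C.Huu) : D.PiTemp) = 1)
    (h₁ : D.toTheta (((a : D.PiTemp))⁻¹ * ((b : C.Huu) : D.PiTemp) * (a : D.PiTemp) * (((b : C.Huu) : D.PiTemp))⁻¹) ∈ D.lDeltaTheta l)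
    (hgen : ∀ u : MuN p M, ∃ m : ℤ, ((τ.mod M).red ⟨_, h₁⟩) ^ m = u) :
    ∀ u : MuN p M, ∃ (m : ℤ) (hm : D.toTheta ((((a ^ m : C.Huu) : D.PiTemp))⁻¹ * ((b : C.Huu) : D.PiTemp) *
        ((a ^ m : C.Huu) : D.PiTemp) * (((b : C.Huu) : D.PiTemp))⁻¹) ∈ D.lDeltaTheta l), (τ.mod M).red ⟨_, hm⟩ = u := by
  intro u
  obtain ⟨m, hm⟩ := hgen u
  have heq : D.toTheta ((((a ^ m : C.Huu) : D.PiTemp))⁻¹ * ((b : C.Huu) : D.PiTemp) * ((a ^ m : C.Huu) : D.PiTemp) *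
      (((b : C.Huu) : D.PiTemp))⁻¹) =
      D.toTheta (((a : D.PiTemp))⁻¹ * ((b : C.Huu) : D.PiTemp) * (a : D.PiTemp) * (((b : C.Huu) : D.PiTemp))⁻¹) ^ m := by
    rw [Subgroup.coe_zpow]
    exact D.toTheta_conj_zpow_comm (a : D.PiTemp) ((b : C.Huu) : D.PiTemp) ha hb m
  have hmem : D.toTheta ((((a ^ m : C.Huu) : D.PiTemp))⁻¹ * ((b : C.Huu) : D.PiTemp) * ((a ^ m : C.Huu) : D.PiTemp) *
      (((b : C.Huu) : D.PiTemp))⁻¹) ∈ D.lDeltaTheta l := by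
    rw [heq]; exact Subgroup.zpow_mem _ h₁ m
  refine ⟨m, hmem, ?_⟩
  have hsub : (⟨_, hmem⟩ : D.lDeltaTheta l) = ⟨_, h₁⟩ ^ m := by
    apply Subtype.ext
    change D.toTheta _ = ((⟨_, h₁⟩ ^ m : D.lDeltaTheta l) : D.GtpTheta)
    rw [Subgroup.coe_zpow]
    exact heq
  rw [hsub, map_zpow, hm]

end ThetaSetting.EtaleThetaData.DoubleUnderline

namespace ThetaSetting.EtaleThetaData.DoubleUnderline

variable {p : ℕ} [Fact p.Prime] {D : ThetaSetting p} {E : D.EtaleThetaData} {l : ℕ}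
  (C : E.DoubleUnderline l) {Es : Set ℕ+} (τ : D.CyclotomeTower l Es)

/-- **(D1*) from DENSITY.**  Write `Δ_P ≤ Π^tp_Ÿ̲̲` for the kernel of `aug` (a topological group).  If the subgroup of `Δ_P` generated by
`Δ_P ∩ θ⁻¹(Δ_Θ)` and ONE element `b` is dense in `Δ_P`, then two locally constant `μ_M`-valued functions on `Π^tp_Ÿ̲̲` that are multiplicative
on `Δ_P`, agree on `Δ_P ∩ θ⁻¹(Δ_Θ)` and at `b` agree on `Δ_P` (`MonoidHom.eq_of_eqOn_of_dense_closure` on `Δ_P`; `μ_M` is discrete).  This is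
the hypothesis (D1*) of `heart_of_uniqueness_of_onto′`; at a model it is the statement «`Δ_P/(Δ_P ∩ θ⁻¹(Δ_Θ))` is topologically generated by
`b`» (the ŷ-coordinate). [cite: MochizukiEtTh2009, Cor 2.19(iii) p.65] -/
theorem uniqueness_on_DeltaP_of_dense (hC : D.Compat) (hS : D.Sec2Hyps) (M : Es)
    (b : (C.thetaEnvTower τ hC hS).PiYdd)
    (hdense : Dense ((Subgroup.closure
        {x : ↥(D.aug.toMonoidHom.comp (C.Huu.subtype.comp ((C.thetaEnvTower τ hC hS).PiYdd).subtype)).ker |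
          D.toTheta ((((x : (C.thetaEnvTower τ hC hS).PiYdd) : C.Huu)) : D.PiTemp) ∈ D.DeltaTheta ∨
            (x : (C.thetaEnvTower τ hC hS).PiYdd) = b} :
        Subgroup ↥(D.aug.toMonoidHom.comp (C.Huu.subtype.comp ((C.thetaEnvTower τ hC hS).PiYdd).subtype)).ker) :
      Set ↥(D.aug.toMonoidHom.comp (C.Huu.subtype.comp ((C.thetaEnvTower τ hC hS).PiYdd).subtype)).ker)) :
    ∀ φ ψ : (C.thetaEnvTower τ hC hS).PiYdd → MuN p M, IsLocallyConstant φ → IsLocallyConstant ψ →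
      (∀ g h : (C.thetaEnvTower τ hC hS).PiYdd, D.aug.toMonoidHom ((g : C.Huu) : D.PiTemp) = 1 →
        D.aug.toMonoidHom ((h : C.Huu) : D.PiTemp) = 1 → φ (g * h) = φ g * φ h) →
      (∀ g h : (C.thetaEnvTower τ hC hS).PiYdd, D.aug.toMonoidHom ((g : C.Huu) : D.PiTemp) = 1 →
        D.aug.toMonoidHom ((h : C.Huu) : D.PiTemp) = 1 → ψ (g * h) = ψ g * ψ h) →
      (∀ g : (C.thetaEnvTower τ hC hS).PiYdd, D.aug.toMonoidHom ((g : C.Huu) : D.PiTemp) = 1 →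
        D.toTheta ((g : C.Huu) : D.PiTemp) ∈ D.DeltaTheta → φ g = ψ g) →
      φ b = ψ b →
      ∀ g : (C.thetaEnvTower τ hC hS).PiYdd, D.aug.toMonoidHom ((g : C.Huu) : D.PiTemp) = 1 → φ g = ψ g := by
  intro φ ψ hφ hψ hφm hψm hK hbb g hg
  -- membership in `Δ_P` unfolded
  have memΔ : ∀ x : (C.thetaEnvTower τ hC hS).PiYdd,
      x ∈ (D.aug.toMonoidHom.comp (C.Huu.subtype.comp ((C.thetaEnvTower τ hC hS).PiYdd).subtype)).ker ↔
        D.aug.toMonoidHom ((x : C.Huu) : D.PiTemp) = 1 := fun x => by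
    rw [MonoidHom.mem_ker]; rfl
  -- the two functions restricted to `Δ_P` as monoid homomorphisms
  have one_of : ∀ χ : (C.thetaEnvTower τ hC hS).PiYdd → MuN p M,
      (∀ g h : (C.thetaEnvTower τ hC hS).PiYdd, D.aug.toMonoidHom ((g : C.Huu) : D.PiTemp) = 1 →
        D.aug.toMonoidHom ((h : C.Huu) : D.PiTemp) = 1 → χ (g * h) = χ g * χ h) → χ 1 = 1 := fun χ hχ => by
    have h1 : D.aug.toMonoidHom (((1 : (C.thetaEnvTower τ hC hS).PiYdd) : C.Huu) : D.PiTemp) = 1 := by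
      rw [OneMemClass.coe_one, OneMemClass.coe_one, map_one]
    have := hχ 1 1 h1 h1
    rw [mul_one] at this
    exact left_eq_mul.mp this
  let Φ : ∀ χ : (C.thetaEnvTower τ hC hS).PiYdd → MuN p M,
      (∀ g h : (C.thetaEnvTower τ hC hS).PiYdd, D.aug.toMonoidHom ((g : C.Huu) : D.PiTemp) = 1 →
        D.aug.toMonoidHom ((h : C.Huu) : D.PiTemp) = 1 → χ (g * h) = χ g * χ h) →
      (↥(D.aug.toMonoidHom.comp (C.Huu.subtype.comp ((C.thetaEnvTower τ hC hS).PiYdd).subtype)).ker →* MuN p M) :=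
    fun χ hχ =>
      { toFun := fun x => χ x
        map_one' := one_of χ hχ
        map_mul' := fun x y => hχ _ _ ((memΔ _).1 x.2) ((memΔ _).1 y.2) }
  have hcont : ∀ χ hχ, IsLocallyConstant χ → Continuous (Φ χ hχ) := fun χ hχ hlc =>
    hlc.continuous.comp continuous_subtype_val
  -- the two homomorphisms agree on the generating set, hence everywhere on `Δ_P`
  have hEq : Φ φ hφm = Φ ψ hψm := by
    refine MonoidHom.eq_of_eqOn_of_dense_closure (hcont φ hφm hφ) (hcont ψ hψm hψ) hdense ?_
    rintro x (hx | hx)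
    · exact hK _ ((memΔ _).1 x.2) hx
    · change φ (x : (C.thetaEnvTower τ hC hS).PiYdd) = ψ (x : (C.thetaEnvTower τ hC hS).PiYdd)
      rw [hx]; exact hbb
  have := DFunLike.congr_fun hEq ⟨g, (memΔ g).2 hg⟩
  exact this

end ThetaSetting.EtaleThetaData.DoubleUnderline

/-! ## §3 (v3, append-only). M1 from the TWO model facts: density in `Δ_P` and the powers of one commutator -/

namespace ThetaSetting.EtaleThetaData.DoubleUnderline

variable {p : ℕ} [Fact p.Prime] {D : ThetaSetting p} {E : D.EtaleThetaData} {l : ℕ}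
  (C : E.DoubleUnderline l) {Es : Set ℕ+} (τ : D.CyclotomeTower l Es)

/-- **M1 (the heart of Cor. 2.19 (iii)) FROM THE TWO MODEL FACTS.**  Over ANY §1 setting, given the Cor. 2.19 (iii) data at level `M`
(`γ` stabilising `Π^tp_Ÿ̲̲` and `θ⁻¹(l·Δ_Θ)`, `γ̃`, an admitted `γ̄_M`, a root cocycle `f` and its transport `F` with clauses (a)(b)(c) of
`exists_transport`), a geometric `ã ∈ Π^tp_X̲̲` and `b ∈ Δ_P`: IF (i) the subgroup of `Δ_P` generated by `Δ_P ∩ θ⁻¹(Δ_Θ)` and `b` is DENSE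
in `Δ_P`, and (ii) the integer powers of `red_M θ[ã⁻¹, b]` exhaust `μ_M`, THEN `∃ m : ℤ, ∀ k ∈ Δ_P, red_M (F k) = red_M (conjRoot (ã^m) f k)`.
At `modelχq p 1 2` (i) is «the ŷ-coordinate topologically generates `Δ_P` modulo `θ⁻¹(Δ_Θ)`» and (ii) is «`[a^l, b]` generates `l·Δ_Θ`
modulo `M`» — the two inputs left to the model seat. [cite: MochizukiEtTh2009, Cor 2.19(iii) p.65] -/
theorem heart_of_dense_of_zpowers (hC : D.Compat) (hS : D.Sec2Hyps) (h15 : Prop15iii E hC)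
    (γ : (C.thetaEnvTower τ hC hS).PiX ≃ₜ* (C.thetaEnvTower τ hC hS).PiX)
    (hγ : (C.thetaEnvTower τ hC hS).PiYdd.map γ.toMulEquiv.toMonoidHom = (C.thetaEnvTower τ hC hS).PiYdd)
    (hL : (C.thetaEnvTower τ hC hS).lDeltaTheta.map γ.toMulEquiv.toMonoidHom = (C.thetaEnvTower τ hC hS).lDeltaTheta)
    (γΛ : D.lDeltaTheta l ≃* D.lDeltaTheta l)
    (hγΛ : ∀ (g : (C.thetaEnvTower τ hC hS).lDeltaTheta) (hg : γ g ∈ (C.thetaEnvTower τ hC hS).lDeltaTheta),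
      C.toLDelta ⟨γ g, hg⟩ = γΛ (C.toLDelta g))
    (M : Es) (γμ : (C.thetaEnvTower τ hC hS).mu M ≃* (C.thetaEnvTower τ hC hS).mu M)
    {f : contCocycles D.toTheta D.DeltaTheta C.GtpYdduu} (hf : f ∈ C.rootCocycles hC)
    (F : C.GtpYdduu → D.lDeltaTheta l)
    (hF : ∀ g : (C.thetaEnvTower τ hC hS).PiYdd,
      F (C.inclYdduu g) = γΛ.symm ⟨(f.1 (C.inclYdduu ⟨γ g, C.apply_mem_PiYdd τ hC hS γ hγ g⟩) : D.GtpTheta), hf.1 _⟩)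
    (hFmul : ∀ g h : C.GtpYdduu, (F (g * h) : D.GtpTheta) =
      (F g : D.GtpTheta) * (D.toTheta (g : D.PiTemp) * (F h : D.GtpTheta) * (D.toTheta (g : D.PiTemp))⁻¹))
    (hFc : (C.thetaEnvTower τ hC hS).pullbackCocycle M γ hγ γμ (C.modN (τ.mod M) f hf.1) =
      fun g => (τ.mod M).red (F (C.inclYdduu g)))
    (a : C.Huu) (ha : D.aug.toMonoidHom (a : D.PiTemp) = 1)
    (b : (C.thetaEnvTower τ hC hS).PiYdd) (hb : D.aug.toMonoidHom ((b : C.Huu) : D.PiTemp) = 1)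
    -- (i) density
    (hdense : Dense ((Subgroup.closure
        {x : ↥(D.aug.toMonoidHom.comp (C.Huu.subtype.comp ((C.thetaEnvTower τ hC hS).PiYdd).subtype)).ker |
          D.toTheta ((((x : (C.thetaEnvTower τ hC hS).PiYdd) : C.Huu)) : D.PiTemp) ∈ D.DeltaTheta ∨
            (x : (C.thetaEnvTower τ hC hS).PiYdd) = b} :
        Subgroup ↥(D.aug.toMonoidHom.comp (C.Huu.subtype.comp ((C.thetaEnvTower τ hC hS).PiYdd).subtype)).ker) :
      Set ↥(D.aug.toMonoidHom.comp (C.Huu.subtype.comp ((C.thetaEnvTower τ hC hS).PiYdd).subtype)).ker))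
    -- (ii) the powers of one commutator
    (h₁ : D.toTheta (((a : D.PiTemp))⁻¹ * ((b : C.Huu) : D.PiTemp) * (a : D.PiTemp) * (((b : C.Huu) : D.PiTemp))⁻¹) ∈ D.lDeltaTheta l)
    (hgen : ∀ u : MuN p M, ∃ m : ℤ, ((τ.mod M).red ⟨_, h₁⟩) ^ m = u) :
    ∃ m : ℤ, ∀ g : (C.thetaEnvTower τ hC hS).PiYdd, D.aug.toMonoidHom ((g : C.Huu) : D.PiTemp) = 1 →
      (τ.mod M).red (F (C.inclYdduu g)) =
        (τ.mod M).red ⟨(C.conjRoot hC (a ^ m) f.1 (C.inclYdduu g) : D.GtpTheta),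
          (D.lDeltaTheta_normal l).conj_mem _ (hf.1 _) _⟩ :=
  C.heart_of_uniqueness_of_onto' τ hC hS h15 γ hγ hL γΛ hγΛ M γμ hf F hF hFmul hFc a ha b hb
    (C.uniqueness_on_DeltaP_of_dense τ hC hS M b hdense)
    (C.onto_of_zpowers_comm τ hC hS M a ha b hb h₁ hgen)

end ThetaSetting.EtaleThetaData.DoubleUnderline

end Literature.AnabelianGeometry.EtaleTheta

end
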